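import Literature.Barriers.PneNP.GCTOccurrenceObstructions
import Literature.Computability.AlgebraicComplexity.MultiplicityObstructionsProofs
import Literature.Computability.Complexity.OccurrenceObstructionsDischarge
import HarnessLib

/-!
# Barrier catalogue `PneNP`, GCT occurrence obstructions: the padding-free conjectures (proofs)

Sibling proof file of `GCTOccurrenceObstructions.lean` (D-0014); no new definitions.

That file records, next to the Bürgisser–Ikenmeyer–Panova barrier, the two technique classes the
barrier does NOT cover, as open conjectures in the quantifier shape of BIP's Conj. 1.3:
`Literature.Barriers.PneNP.PowOccurrenceObstructionConjecture` (occurrence obstructions for `per_m`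
versus the matrix power trace `Pow^m_n = tr(X^m)`, `n = m^c`, Gesmundo–Ikenmeyer–Panova's
homogeneous setting) and `Literature.Barriers.PneNP.IMMOccurrenceObstructionConjecture` (versus
`IMM_{n,m} = tr(X_1 ⋯ X_m)`). Both are OPEN in print and are `def … : Prop` only (CONVENTIONS:
"never assert an open problem as a `theorem`"); neither has a `_holds` discharge:

* the cited source proves the opposite kind of statement for the ORBIT version — "Let `m ≥ 10`
  and `n ≥ m + 2`. For every `λ ⊢ dm` that satisfies `q_λ(d[m]) > 0` we have `sm(λ, n) > 0`"
  [GesmundoIkenmeyerPanova2017, Thm. 10 (Main Result); tree: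
  `Literature.Barriers.ValiantsHypothesis.GIP2017_thm10`] — and says of the closure version only that
  BIP's lifting "to the closure ... appears to be challenging in the homogeneous setting because
  of the absence of the padding" [GesmundoIkenmeyerPanova2017, remark after Thm. 10];
* "While this makes it unlikely that occurrence obstructions could do the job, this is not
  excluded by this paper" [Burgisser2024Completeness, §7.5]; "There are no no-go results known for
  this approach" (the `IMM` model) [DuttaGesmundoIkenmeyerJindalLysikov2024, §1].

What this file PROVES is the strength of the conjectures, i.e. the Schur's-lemma step of the
obstruction principle in the homogeneous setting [GesmundoIkenmeyerPanova2017, §2.2: Prop. 5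
"If `\overline{GL_{n²} per_m} ⊄ \overline{GL_{n²} Pow^m_n}`, then `pc(per_m) > n`", the
splittings defining `q_λ(d[m])`, `t_{λ,n}(d[m])`, and Cor. 6 "If `q_λ(d[m]) > t_{λ,n}(d[m])`, then
`pc(per_m) > n`" ("As in the padded setting Schur's lemma implies")]: a weight occurring in
`ℂ[\overline{GL · per_m}]` but not in `ℂ[\overline{GL · Pow^m_n}]` forces
`per_m ∉ \overline{GL_{n²} · Pow^m_n}`, because occurrence transports along orbit-closure
containment (`hasHighestWeight_orbitCoordRep_of_mem_orbitClosure'` below, the argument of the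
tree's `CplxAlg.hasHighestWeight_orbitCoordRep_of_mem_orbitClosure` in
`Literature/Computability/Complexity/OccurrenceObstructionsProofs.lean`: `g ∈ \overline{GL f}` gives
`I(GL · f) ≤ I(GL · g)` (`CplxAlg.orbitVanishingIdeal_le_of_mem_orbitClosure`), so restriction
`ℂ[\overline{GL f}] ↠ ℂ[\overline{GL g}]` is an equivariant surjection out of a completely
reducible module (`CplxAlg.isSemisimpleRepresentation_orbitCoordRep`), along which highest-weight
vectors lift (`CplxAlg.hasHighestWeight_of_surjective`)). Hence a proof of
`PowOccurrenceObstructionConjecture` separates, for every exponent `c ≥ 1` and infinitely many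
`m`, the orbit closure of `per_m` from that of `Pow^m_{m^c}` — exactly the hypothesis of Prop. 5
at `n = m^c`, i.e. `pc(per_m) > m^c` infinitely often for every `c`, the superpolynomial growth
of `pc(per_m)` that is "equivalent" to Valiant's Conj. 1 (`dc(per_m)` superpolynomial) by Nisan's
homogenisation [GesmundoIkenmeyerPanova2017, §2.2 (2.2)]. The same for the `IMM` model
[Burgisser2024Completeness, §7.5: "The goal is to show that the smallest `n`, for which `per_m`
lies in the orbit closure of `IMM_{n,m}`, grows superpolynomially in `m`"]. The conjectures are
therefore at least as strong as the (border) permanent lower bounds they were designed to prove,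
and are not dischargeable facts.

## The barrier itself, discharged (BIP Thm. 1.4 unconditionally)

The last section feeds the parent file's conditional theorems with the tree's discharge of
Bürgisser–Ikenmeyer–Panova's theorem: `GCTOccurrenceObstructions` is *by definition* the fact
`Literature.Computability.Complexity.bip2019_no_occurrence_obstructions` (BIP Thm. 1.4 as printed,
BIP's own padding `X₁₁ ∈ per_m`, weight form), and that fact is a theorem of the tree,
`Literature.Computability.Complexity.bip2019_no_occurrence_obstructions_holds`
(`OccurrenceObstructionsDischarge.lean`: BIP §6 "Proof of Theorem 1.4" run on the proved
Thm. 2.1, Lemma 2.2, Prop. 2.3, Prop. 2.4, Thm. 2.5, Prop. 3.2, Thm. 4.9, Props. 5.6(2), 5.8(2),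
Prop. 6.1, Thm. 6.2 (explicit tableaux of §7), Prop. 6.3, and the BLMW lift of `Polarization.lean`).
Hence `GCTOccurrenceObstructions_holds`, the refutation of BIP's Conj. 1.3
(`not_occurrenceObstructionConjecture_holds`, "In particular, Conjecture 1.3 is false"; the
conjecture is spelled out, its retired name `OccurrenceObstructionConjecture` in the parent file
being a deprecated tombstone) and the predicate forms without hypothesis
`h : GCTOccurrenceObstructions`; and the narrowed barrier
`GCTOccurrenceObstructionsNarrow` (the padded-shape core of the printed proof) holds by
`GCTOccurrenceObstructionsNarrow.of_parts` on the discharged Props. 2.4, 6.1, 6.3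
(`GCTOccurrenceObstructionsNarrow_holds`), and gives the barrier back through the proved
Thm. 2.1 and lift (`GCTOccurrenceObstructions_holds_of_narrow`, a second, definitionally
independent route to the same statement). [BurgisserIkenmeyerPanovaJAMS2019, Thm. 1.4 and §6]

Letters as in the parent file: `m` = permanent size = degree, matrix size `m ^ c`; over `ℂ`.

## References

* [GesmundoIkenmeyerPanova2017] F. Gesmundo, C. Ikenmeyer, G. Panova, *Geometric complexity
  theory and matrix powering*, Diff. Geom. Appl. 55 (2017) 106–127 = arXiv:1611.00827 (held,
  `lit read`): §2.2 (Prop. 5, Cor. 6, (2.2)), Thm. 10 and the remark after it.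
* [Burgisser2024Completeness] P. Bürgisser, arXiv:2406.06217, §7.5 (pp. 30–31).
* [DuttaGesmundoIkenmeyerJindalLysikov2024] arXiv:2311.17019, §1.
* [BurgisserIkenmeyerPanovaJAMS2019] §1 (arXiv:1604.06431v3 p. 3: "the restriction defines a
  surjective `G`-equivariant homomorphism `ℂ[Ω_n] → ℂ[Z_{n,m}]` of the coordinate rings. Schur's
  lemma implies that if `λ` occurs in `ℂ[Z_{n,m}]`, then it must also occur in `ℂ[Ω_n]`").
* [BlaeserIkenmeyer2025] M. Bläser, C. Ikenmeyer, *Introduction to geometric complexity theory*,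
  §12.4 with Cor. 12.6 (the lifting along `ℂ[Z]_δ ↠ ℂ[Z₀]_δ`), as cited by the tree's
  `MultiplicityObstructionsProofs.lean`.
* [BurgisserIkenmeyerPanovaJAMS2019] Thm. 1.4 (held text arXiv:1604.06431, p. 4, flat
  numbering "Theorem 4": "Let `n,d,m` be positive integers with `n ≥ m^25` and `λ ⊢ nd`. If `λ`
  occurs in `ℂ[Z_{n,m}]`, then `λ` also occurs in `ℂ[Ω_n]`. In particular, Conjecture
  (conj:occ-obstr) is false."), §6 (Proof of Theorem 1.4); tree discharge
  `Literature/Computability/Complexity/OccurrenceObstructionsDischarge.lean`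
  (`bip2019_no_occurrence_obstructions_holds`), `PlethysmStabilityBIP.lean`
  (`bip2019_prop_2_4_holds`, `bip2019_prop_6_1_holds`), `OccurrenceObstructionsHookTableaux.lean`
  (`bip2019_prop_6_3_holds`, `bip2019_thm_6_2_holds`), `OccurrenceObstructionsBIP.lean`
  (`bip2019_thm_2_1_holds`), `Polarization.lean`
  (`CplxAlg.hasHighestWeight_coordRep_of_orbitCoordRep_holds`).
-/

noncomputable section

namespace Literature.Barriers.PneNP

open Literature.Computability.AlgebraicComplexity Literature.NumberTheory.DiophantineGeometry MvPolynomial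

/-- **Occurrence transports along orbit-closure containment** (characteristic zero; the
argument of the tree's `CplxAlg.hasHighestWeight_orbitCoordRep_of_mem_orbitClosure`, restated here
over the imports of this file): if `g ∈ \overline{GL · f}` then every weight `χ` occurring in
`k[\overline{GL · g}]` (degree-`m` coordinates) occurs in `k[\overline{GL · f}]` — `I(GL · f) ≤ I(GL · g)`,
the factor map `k[Sym^m]/I(GL · f) ↠ k[Sym^m]/I(GL · g)` is a `GL`-equivariant surjection, the
source is completely reducible, and highest-weight vectors lift. "the restriction defines a
surjective `G`-equivariant homomorphism ... Schur's lemma implies that if `λ` occurs in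
`ℂ[Z_{n,m}]`, then it must also occur in `ℂ[Ω_n]`". [cite: BurgisserIkenmeyerPanovaJAMS2019, §1 (arXiv:1604.06431v3 p. 3)] -/
theorem hasHighestWeight_orbitCoordRep_of_mem_orbitClosure' {σ k : Type*} [Fintype σ]
    [LinearOrder σ] [Field k] [CharZero k] {f g : MvPolynomial σ k} {m : ℕ}
    (hmem : g ∈ orbitClosure f) {χ : Weight σ} (h : HasHighestWeight (orbitCoordRep g m) χ) :
    HasHighestWeight (orbitCoordRep f m) χ := by
  have hle : orbitVanishingIdeal f m ≤ orbitVanishingIdeal g m :=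
    orbitVanishingIdeal_le_of_mem_orbitClosure hmem
  -- the factor map `k[Sym^m]/I(GL f) → k[Sym^m]/I(GL g)` (identity on representatives)
  let res : OrbitCoordRing f m →ₐ[k] OrbitCoordRing g m :=
    Ideal.quotientMapₐ (orbitVanishingIdeal g m) (AlgHom.id k _) (by simpa using hle)
  have res_mk : ∀ F : MvPolynomial (DegIdx σ m) k,
      res (Ideal.Quotient.mk (orbitVanishingIdeal f m) F) =
        Ideal.Quotient.mk (orbitVanishingIdeal g m) F := fun F => rfl
  -- it is an equivariant surjection
  let π : (orbitCoordRep f m).IntertwiningMap (orbitCoordRep g m) :=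
    { toLinearMap := res.toLinearMap
      isIntertwining' := fun A => by
        refine LinearMap.ext fun x => ?_
        obtain ⟨F, rfl⟩ := Ideal.Quotient.mk_surjective x
        simp only [LinearMap.coe_comp, Function.comp_apply, AlgHom.toLinearMap_apply,
          orbitCoordRep_apply, orbitCoordSubst_mk, res_mk] }
  have hπ : Function.Surjective π := by
    intro y
    obtain ⟨F, rfl⟩ := Ideal.Quotient.mk_surjective y
    exact ⟨Ideal.Quotient.mk _ F, res_mk F⟩
  exact hasHighestWeight_of_surjective π hπ (isSemisimpleRepresentation_orbitCoordRep f m) h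

/-- **The obstruction principle, homogeneous setting (Schur's-lemma step of GIP Prop. 5 /
Cor. 6).** For forms `f, g` of degree `m` in the same linearly ordered variables over `ℂ`: a
weight `χ` occurring in `ℂ[\overline{GL · g}]` but not in `ℂ[\overline{GL · f}]` shows
`g ∉ \overline{GL · f}`. [cite: GesmundoIkenmeyerPanova2017, §2.2 (Cor. 6, "As in the padded setting Schur's lemma implies")] -/
theorem not_mem_orbitClosure_of_hasHighestWeight_of_not {σ : Type*} [Fintype σ] [LinearOrder σ]
    {f g : MvPolynomial σ ℂ} {m : ℕ} {χ : Weight σ}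
    (hg : HasHighestWeight (orbitCoordRep g m) χ) (hf : ¬ HasHighestWeight (orbitCoordRep f m) χ) :
    g ∉ orbitClosure f :=
  fun hmem => hf (hasHighestWeight_orbitCoordRep_of_mem_orbitClosure' hmem hg)

/-- **What `PowOccurrenceObstructionConjecture` delivers: separation of orbit closures in the
matrix-powering model, in every polynomial regime.** If the conjecture holds then for every
`c ≥ 1` and every `m₀` there is `m ≥ m₀`, `m ≥ 1`, with
`per_m ∉ \overline{GL_{n²} · Pow^m_n}`, `n = m^c` (unpadded block permanent `blockPerFormLex`,
power trace `powTraceFormLex`) — so `\overline{GL_{n²} per_m} ⊄ \overline{GL_{n²} Pow^m_n}` and,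
by GIP Prop. 5, `pc(per_m) > m^c`; over all `c` this is the superpolynomial growth of `pc(per_m)`,
equivalent to Valiant's conjecture [cite: GesmundoIkenmeyerPanova2017, §2.2 (Prop. 5 and (2.2))].
The conjecture itself is OPEN (closure version "not excluded" [cite: Burgisser2024Completeness, §7.5]);
this theorem records its strength, not its truth. [cite: GesmundoIkenmeyerPanova2017, §2.2 (Prop. 5, Cor. 6)] -/
theorem PowOccurrenceObstructionConjecture.not_mem_orbitClosure
    (h : PowOccurrenceObstructionConjecture) {c : ℕ} (hc : 1 ≤ c) (m₀ : ℕ) :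
    ∃ m : ℕ, m₀ ≤ m ∧ 1 ≤ m ∧
      blockPerFormLex m (m ^ c) ∉ orbitClosure (powTraceFormLex (m ^ c) m) := by
  obtain ⟨m, hm₀, hm, χ, hper, hpow⟩ := h c hc m₀
  exact ⟨m, hm₀, hm, not_mem_orbitClosure_of_hasHighestWeight_of_not hper hpow⟩

/-- The same in the literal form of GIP Prop. 5's hypothesis: for every `c ≥ 1`, for infinitely
many `m`, `\overline{GL_{n²} per_m} ⊄ \overline{GL_{n²} Pow^m_n}` with `n = m^c`.
[cite: GesmundoIkenmeyerPanova2017, Prop. 5] -/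
theorem PowOccurrenceObstructionConjecture.not_orbitClosure_subset
    (h : PowOccurrenceObstructionConjecture) {c : ℕ} (hc : 1 ≤ c) (m₀ : ℕ) :
    ∃ m : ℕ, m₀ ≤ m ∧ 1 ≤ m ∧
      ¬ orbitClosure (blockPerFormLex m (m ^ c)) ⊆ orbitClosure (powTraceFormLex (m ^ c) m) := by
  obtain ⟨m, hm₀, hm, hnot⟩ := h.not_mem_orbitClosure hc m₀
  exact ⟨m, hm₀, hm, fun hsub => hnot (hsub (mem_orbitClosure_self _))⟩

/-- **What `IMMOccurrenceObstructionConjecture` delivers: separation of orbit closures in the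
iterated-matrix-multiplication model, in every polynomial regime.** If the conjecture holds then
for every `c ≥ 1` and every `m₀` there is `m ≥ m₀`, `m ≥ 1`, with
`per_m ∉ \overline{GL_{m n²} · IMM_{n,m}}`, `n = m^c` (`immBlockPerFormLex`, `immFormLex`): the
least width `n` with `per_m ∈ \overline{GL · IMM_{n,m}}` exceeds `m^c` infinitely often for every
`c` — "The goal is to show that the smallest `n`, for which `per_m` lies in the orbit closure of
`IMM_{n,m}`, grows superpolynomially in `m`. It is unknown whether the method of occurrence
obstructions can achieve this" [cite: Burgisser2024Completeness, §7.5]. OPEN; this theorem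
records the conjecture's strength, not its truth. [cite: DuttaGesmundoIkenmeyerJindalLysikov2024, §1] -/
theorem IMMOccurrenceObstructionConjecture.not_mem_orbitClosure
    (h : IMMOccurrenceObstructionConjecture) {c : ℕ} (hc : 1 ≤ c) (m₀ : ℕ) :
    ∃ m : ℕ, m₀ ≤ m ∧ 1 ≤ m ∧
      immBlockPerFormLex m (m ^ c) ∉ orbitClosure (immFormLex (m ^ c) m) := by
  obtain ⟨m, hm₀, hm, χ, hper, himm⟩ := h c hc m₀
  exact ⟨m, hm₀, hm, not_mem_orbitClosure_of_hasHighestWeight_of_not hper himm⟩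

/-- The same in containment form: for every `c ≥ 1`, for infinitely many `m`,
`\overline{GL per_m} ⊄ \overline{GL IMM_{m^c,m}}`. [cite: Burgisser2024Completeness, §7.5] -/
theorem IMMOccurrenceObstructionConjecture.not_orbitClosure_subset
    (h : IMMOccurrenceObstructionConjecture) {c : ℕ} (hc : 1 ≤ c) (m₀ : ℕ) :
    ∃ m : ℕ, m₀ ≤ m ∧ 1 ≤ m ∧
      ¬ orbitClosure (immBlockPerFormLex m (m ^ c)) ⊆ orbitClosure (immFormLex (m ^ c) m) := by
  obtain ⟨m, hm₀, hm, hnot⟩ := h.not_mem_orbitClosure hc m₀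
  exact ⟨m, hm₀, hm, fun hsub => hnot (hsub (mem_orbitClosure_self _))⟩

/-! ### The barrier discharged: BIP Thm. 1.4 and "Conjecture 1.3 is false", unconditionally -/

/-- **`GCTOccurrenceObstructions` holds (Bürgisser–Ikenmeyer–Panova, J. AMS 32 (2019),
Thm. 1.4): "Let `n, d, m` be positive integers with `n ≥ m^25` and `λ ⊢ nd`. If `λ` occurs in
`ℂ[Z_{n,m}]`, then `λ` also occurs in `ℂ[Ω_n]`."** The barrier fact is definitionally the tree
fact `Literature.Computability.Complexity.bip2019_no_occurrence_obstructions` (BIP's own padding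
`X₁₁ ∈ per`, weight form; tree letters permanent `n`, determinant `m`, `0 < n`, `n ^ 25 ≤ m`),
which the tree proves as `Literature.Computability.Complexity.bip2019_no_occurrence_obstructions_holds`
(`OccurrenceObstructionsDischarge.lean`): BIP §6 "Proof of Theorem 1.4" with `M = n` on the
proved Thm. 2.1 (Kadish–Landsberg shape), Lemma 2.2 (semigroup property), Prop. 2.3 (even
rectangles, Cayley's hyperdeterminant), Prop. 2.4 (small degrees) and Prop. 6.1 (extremely long
first rows) via the plethysm stabilities Props. 5.6(2), 5.8(2) and Prop. 3.2, Thm. 2.5 (padded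
power sums), Prop. 6.3 (splitting), Thm. 6.2 (the explicit tableaux of §7) and the BLMW lift
`ℂ[Sym^m V^*] ↠ ℂ[Z]` (`CplxAlg.hasHighestWeight_coordRep_of_orbitCoordRep_holds`). Trust base:
the axiom whitelist only. [cite: BurgisserIkenmeyerPanovaJAMS2019, Thm. 1.4 and §6 (Proof of Theorem 1.4)] -/
theorem GCTOccurrenceObstructions_holds : GCTOccurrenceObstructions :=
  Literature.Computability.Complexity.bip2019_no_occurrence_obstructions_holds

/-- **BIP Thm. 1.4, "In particular, Conjecture 1.3 is false" — unconditionally.** The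
occurrence-obstruction conjecture of Mulmuley–Sohoni in BIP's convention — BIP Conj. 1.3: "For
all `c ∈ ℕ_{≥1}`, for infinitely many `m`, there exists a partition `λ` occurring in
`ℂ[Z_{m^c,m}]` but not in `ℂ[Ω_{m^c}]`", here spelled out in the tree's letters (for all `c ≥ 1`,
for infinitely many `n ≥ 1`, some weight occurs in `ℂ[\overline{GL · X₀₀^{n^c-n} per_n}]` but not
in `ℂ[\overline{GL · det_{n^c}}]`; weight form, `NeZero (n ^ c)` as a binder) — is false: the
parent file's `GCTOccurrenceObstructions.not_occurrenceObstructionConjecture` (same statement) fed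
with `GCTOccurrenceObstructions_holds`. The negand is, definitionally, the parent file's retired
name `OccurrenceObstructionConjecture` (a deprecated tombstone since the 2026-08-15 named-fact
clean-up; this theorem is the `not_<decl>` refutation it points to and no longer mentions the
name). [cite: BurgisserIkenmeyerPanovaJAMS2019, Conj. 1.3 (§1.1) and Thm. 1.4 ("In particular, Conjecture 1.3 is false")] -/
theorem not_occurrenceObstructionConjecture_holds :
    ¬ (∀ c : ℕ, 1 ≤ c → ∀ n₀ : ℕ, ∃ n : ℕ, n₀ ≤ n ∧ 1 ≤ n ∧
      ∀ [NeZero (n ^ c)], ∃ χ : Weight (MatIdx (n ^ c)),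
        HasHighestWeight (Literature.Computability.Complexity.bipPaddedPerOrbitRep ℂ n (n ^ c)) χ ∧
          ¬ HasHighestWeight (detOrbitRep ℂ (n ^ c)) χ) :=
  GCTOccurrenceObstructions_holds.not_occurrenceObstructionConjecture

/-- **No occurrence obstruction at `(n, m)` once `n ^ 25 ≤ m`, `0 < n` (BIP's padding),
unconditionally**: there is no weight occurring in `ℂ[Z_{m,n}]` (orbit closure of
`X₀₀^{m-n} per_n`, `X₀₀` a variable of `per_n`) and not in `ℂ[Ω_m]`.
[cite: BurgisserIkenmeyerPanovaJAMS2019, Thm. 1.4] -/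
theorem not_exists_occurrenceObstruction {n m : ℕ} [NeZero m] (hn : 0 < n) (hnm : n ^ 25 ≤ m) :
    ¬ ∃ χ : Weight (MatIdx m),
      HasHighestWeight (Literature.Computability.Complexity.bipPaddedPerOrbitRep ℂ n m) χ ∧
        ¬ HasHighestWeight (detOrbitRep ℂ m) χ :=
  GCTOccurrenceObstructions_holds.not_exists_obstruction hn hnm

/-- The same in the polynomial regime of Conj. 1.2/1.3: for every exponent `c ≥ 25` and every
`n ≥ 1` there is no occurrence obstruction against `X₀₀^{n^c - n} per_n ∈ \overline{GL · det_{n^c}}`,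
unconditionally. [cite: BurgisserIkenmeyerPanovaJAMS2019, Thm. 1.4] -/
theorem not_exists_occurrenceObstruction_pow {c n : ℕ} (hc : 25 ≤ c) (hn : 1 ≤ n)
    [NeZero (n ^ c)] :
    ¬ ∃ χ : Weight (MatIdx (n ^ c)),
      HasHighestWeight (Literature.Computability.Complexity.bipPaddedPerOrbitRep ℂ n (n ^ c)) χ ∧
        ¬ HasHighestWeight (detOrbitRep ℂ (n ^ c)) χ :=
  GCTOccurrenceObstructions_holds.not_exists_obstruction_pow hc hn

/-- **The narrowed barrier holds (audit D-0021: the padded-shape core of BIP's proof,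
unconditionally).** For `M ≥ 1`, `M ^ 25 ≤ m` and `λ ⊢ d·m` with `ℓ(λ) ≤ M²`, `|λ̄| ≤ M d`
occurring in `ℂ[Sym^m V^*]`, the weight `λ^*` occurs in `ℂ[Ω_m]`: the parent file's
`GCTOccurrenceObstructionsNarrow.of_parts` (the tree's case analysis
`Literature.Computability.Complexity.hasHighestWeight_detOrbitRep_of_parts`, BIP §6) fed with the
discharged Prop. 2.4 (`bip2019_prop_2_4_holds`), Prop. 6.1 (`bip2019_prop_6_1_holds`, both
`PlethysmStabilityBIP.lean`) and Prop. 6.3 (`bip2019_prop_6_3_holds`,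
`OccurrenceObstructionsHookTableaux.lean`, from Prop. 2.3 and Thm. 6.2).
[cite: BurgisserIkenmeyerPanovaJAMS2019, §6 (Proof of Theorem 1.4), Props. 2.4, 6.1, 6.3] -/
theorem GCTOccurrenceObstructionsNarrow_holds : GCTOccurrenceObstructionsNarrow :=
  GCTOccurrenceObstructionsNarrow.of_parts
    Literature.Computability.Complexity.bip2019_prop_2_4_holds
    Literature.Computability.Complexity.bip2019_prop_6_1_holds
    Literature.Computability.Complexity.bip2019_prop_6_3_holds

/-- **The barrier from its padded-shape core, unconditionally** (second route to
`GCTOccurrenceObstructions`, through the parent file's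
`GCTOccurrenceObstructionsNarrow.gctOccurrenceObstructions`): the narrowed barrier, the proved
Kadish–Landsberg shape of BIP's padded permanent (Thm. 2.1, `bip2019_thm_2_1_holds`) and the
proved lift `ℂ[Sym^m V^*] ↠ ℂ[Z]` (`CplxAlg.hasHighestWeight_coordRep_of_orbitCoordRep_holds`)
give BIP Thm. 1.4 — confirming formally that the covered technique class is "occurrence
obstructions carried by partitions of padded shape" (the fresh-variable route dies the same way:
`GCTOccurrenceObstructionsNarrow.not_occurrenceObstructionRoute` on the proved Thm. 4.9(1),
Kadish–Landsberg bound and lift is the tree's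
`Literature.Computability.Complexity.not_occurrenceObstructionRoute_holds`, not restated).
[cite: BurgisserIkenmeyerPanovaJAMS2019, Thm. 1.4, Thm. 2.1 and §6 (Proof of Theorem 1.4)] -/
theorem GCTOccurrenceObstructions_holds_of_narrow : GCTOccurrenceObstructions :=
  GCTOccurrenceObstructionsNarrow_holds.gctOccurrenceObstructions
    Literature.Computability.Complexity.bip2019_thm_2_1_holds
    fun _ => hasHighestWeight_coordRep_of_orbitCoordRep_holds

end Literature.Barriers.PneNP

end
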